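import Mathlib
import Summits.Ventures.PercRepro2.BHKPair
import Summits.Ventures.PercRepro2.BHKAvoid
import Summits.Ventures.PercRepro2.PASubDefs

/-!
# The union event `{s ↮ X} ∪ {t ↮ Y}` for separated roots — definitions, the tower identity and
the fibre split (blind cell PercRepro2, mine-1 g33; proofs/MINE1-TFGEN.md §7, Theorem (AQ); part 1/3)

Row 2′CON-U's PA half (`(UNION-PA)`, MINE-1.md §42(2)) asks whether the BHK pair law
`Law(C_s, C_t | s ↮ t)` conditioned on the union of two avoidance events
`U = {C_s ∩ X = ∅} ∪ {C_t ∩ Y = ∅}` is positively associated in the (Z)-order (increasing in `C_s`,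
decreasing in `C_t`). The chain `UnionPASepDefs` → `UnionPASepFibre` → `UnionPASeparated` proves it
when `s` and `t` lie in different components of the underlying graph (`¬ Conn ends allOpen s t`).
This file: the union event, the `{0,1}`-valued cluster indicators `aInd`, the separation lemmas
(`t ∉ C_s`; `C_t` unchanged by deleting the edges at `C_s`), the tower identity
`E[H(C_s, C_t) 1_U] = E[Φ̂_H(C_s)]` (the pattern of `BHKPair.expect_pair_mul_indicator`), and the
fibre split `Φ̂_H(W) = a(W) H₀(H)(W) + (1 - a(W)) H₁(H)(W)` with `H₀(H)(W) = E[H(W, C_t)]`,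
`H₁(H)(W) = E[H(W, C_t) 1_{t ↮ Y}]`.
-/

namespace Summit.Ventures.PercRepro2

namespace UnionSep

variable {V : Type*} {E : Type*} [Fintype E] [DecidableEq E] [Fintype V] [DecidableEq V]
  {R : Type*} [CommRing R] [LinearOrder R] [IsStrictOrderedRing R]

/-! ## The union event and its indicators -/

/-- The union event `{s ↮ X} ∪ {t ↮ Y}` (row 2′CON-U). -/
def unionEvent (ends : E → Sym2 V) (s t : V) (X Y : Finset V) : Set (Config E) :=
  avoidAll ends s X ∪ avoidAll ends t Y

/-- The set-function indicator of `{W : W ∩ X = ∅}`. -/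
noncomputable def aInd (X : Finset V) : Set V → R :=
  fun W => ({W' : Set V | ∀ x ∈ X, x ∉ W'}).indicator 1 W

omit [Fintype E] [DecidableEq E] [Fintype V] [DecidableEq V] [LinearOrder R]
  [IsStrictOrderedRing R] in
/-- `aInd X W = 1` when `W` avoids `X`. -/
lemma aInd_eq_one {X : Finset V} {W : Set V} (h : ∀ x ∈ X, x ∉ W) : (aInd X W : R) = 1 := by
  unfold aInd
  exact Set.indicator_of_mem (show W ∈ {W' : Set V | ∀ x ∈ X, x ∉ W'} from h) _

omit [Fintype E] [DecidableEq E] [Fintype V] [DecidableEq V] [LinearOrder R]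
  [IsStrictOrderedRing R] in
/-- `aInd X W = 0` when `W` meets `X`. -/
lemma aInd_eq_zero {X : Finset V} {W : Set V} (h : ¬ ∀ x ∈ X, x ∉ W) : (aInd X W : R) = 0 := by
  unfold aInd
  exact Set.indicator_of_notMem (show W ∉ {W' : Set V | ∀ x ∈ X, x ∉ W'} from h) _

omit [Fintype E] [DecidableEq E] [Fintype V] [DecidableEq V] in
/-- `0 ≤ aInd`. -/
lemma aInd_nonneg (X : Finset V) (W : Set V) : (0 : R) ≤ aInd X W :=
  Set.indicator_apply_nonneg fun _ => zero_le_one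

omit [Fintype E] [DecidableEq E] [Fintype V] [DecidableEq V] in
/-- `aInd ≤ 1`. -/
lemma aInd_le_one (X : Finset V) (W : Set V) : (aInd X W : R) ≤ 1 := by
  by_cases h : ∀ x ∈ X, x ∉ W
  · rw [aInd_eq_one h]
  · rw [aInd_eq_zero h]; exact zero_le_one

omit [Fintype E] [DecidableEq E] [Fintype V] [DecidableEq V] [LinearOrder R]
  [IsStrictOrderedRing R] in
/-- `aInd` is idempotent (a `{0,1}`-valued function). -/
lemma aInd_mul_self (X : Finset V) (W : Set V) : (aInd X W : R) * aInd X W = aInd X W := by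
  by_cases h : ∀ x ∈ X, x ∉ W
  · rw [aInd_eq_one h]; ring
  · rw [aInd_eq_zero h]; ring

omit [Fintype E] [DecidableEq E] [Fintype V] [DecidableEq V] in
/-- `aInd` is antitone: a larger cluster is less likely to avoid `X`. -/
lemma aInd_antitone (X : Finset V) {W W' : Set V} (h : W ⊆ W') : (aInd X W' : R) ≤ aInd X W := by
  by_cases h' : ∀ x ∈ X, x ∉ W'
  · have : ∀ x ∈ X, x ∉ W := fun x hx hxW => h' x hx (h hxW)
    rw [aInd_eq_one h', aInd_eq_one this]
  · rw [aInd_eq_zero h']; exact aInd_nonneg X W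

omit [Fintype E] [DecidableEq E] [Fintype V] [DecidableEq V] [LinearOrder R]
  [IsStrictOrderedRing R] in
/-- The indicator of `{s ↮ X}` is `aInd X (C_s)`. -/
lemma indicator_avoidAll_eq_aInd (ends : E → Sym2 V) (s : V) (X : Finset V) (ω : Config E) :
    (avoidAll ends s X).indicator (1 : Config E → R) ω = aInd X (cluster ends ω s) := by
  by_cases h : ω ∈ avoidAll ends s X
  · rw [Set.indicator_of_mem h, aInd_eq_one]
    · rfl
    · intro x hx hxc
      exact (mem_avoidAll.1 h) x hx hxc
  · rw [Set.indicator_of_notMem h, aInd_eq_zero]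
    intro h'
    exact h (mem_avoidAll.2 fun x hx hc => h' x hx hc)

omit [Fintype E] [DecidableEq E] [Fintype V] [DecidableEq V] [LinearOrder R]
  [IsStrictOrderedRing R] in
/-- The indicator of the union event, written through the two cluster indicators:
`1_U = a(C_s) + (1 - a(C_s)) b(C_t)`. -/
lemma indicator_unionEvent_eq (ends : E → Sym2 V) (s t : V) (X Y : Finset V) (ω : Config E) :
    (unionEvent ends s t X Y).indicator (1 : Config E → R) ω =
      aInd X (cluster ends ω s) + (1 - aInd X (cluster ends ω s)) * aInd Y (cluster ends ω t) := by
  rw [← indicator_avoidAll_eq_aInd ends s X ω, ← indicator_avoidAll_eq_aInd ends t Y ω]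
  by_cases hA : ω ∈ avoidAll ends s X
  · rw [Set.indicator_of_mem hA, Set.indicator_of_mem (show ω ∈ unionEvent ends s t X Y from
      Or.inl hA)]
    simp
  · rw [Set.indicator_of_notMem hA]
    by_cases hB : ω ∈ avoidAll ends t Y
    · rw [Set.indicator_of_mem hB, Set.indicator_of_mem (show ω ∈ unionEvent ends s t X Y from
        Or.inr hB)]
      simp
    · rw [Set.indicator_of_notMem hB, Set.indicator_of_notMem (show ω ∉ unionEvent ends s t X Y from
        fun h => h.elim hA hB)]
      simp

omit [Fintype E] [DecidableEq E] [Fintype V] [DecidableEq V] in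
/-- `{s ↮ X}` is a lower set of configurations. -/
lemma isLowerSet_avoidAll (ends : E → Sym2 V) (s : V) (X : Finset V) :
    IsLowerSet (avoidAll ends s X) := by
  intro ω ω' h hω
  rw [mem_avoidAll] at hω ⊢
  intro x hx hc
  exact hω x hx (conn_mono h hc)

/-! ## Separated roots -/

/-- The all-open configuration. -/
def allOpen : Config E := fun _ => true

omit [Fintype E] [DecidableEq E] [Fintype V] [DecidableEq V] in
/-- Every configuration is below the all-open one. -/
lemma le_allOpen (ω : Config E) : ω ≤ (allOpen : Config E) := fun _ => Bool.le_true _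

omit [Fintype E] [DecidableEq E] [Fintype V] [DecidableEq V] in
/-- Under separation, `t` never lies in the cluster of `s`. -/
lemma notMem_cluster_of_sep {ends : E → Sym2 V} {s t : V} (hsep : ¬ Conn ends allOpen s t)
    (ω : Config E) : t ∉ cluster ends ω s :=
  fun h => hsep (conn_mono (le_allOpen ω) h)

omit [Fintype E] [DecidableEq E] [Fintype V] [DecidableEq V] in
/-- Under separation, every cluster of `t` avoids every cluster of `s`. -/
lemma cluster_t_subset_compl_of_sep {ends : E → Sym2 V} {s t : V}
    (hsep : ¬ Conn ends allOpen s t) (ω ω' : Config E) :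
    cluster ends ω' t ⊆ (cluster ends ω s)ᶜ := by
  intro v hv hvs
  have h1 : Conn ends allOpen s v := conn_mono (le_allOpen ω) hvs
  have h2 : Conn ends allOpen t v := conn_mono (le_allOpen ω') hv
  exact hsep (conn_trans h1 (conn_symm h2))

omit [Fintype E] [DecidableEq E] [Fintype V] [DecidableEq V] in
/-- Deleting the edges at `W` gives a smaller configuration. -/
lemma delConfig_le' (ends : E → Sym2 V) (W : Set V) (ω : Config E) :
    delConfig ends W ω ≤ ω := by
  intro e
  by_cases h : e ∈ touches ends W
  · rw [delConfig_apply_of_mem h]; exact Bool.false_le _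
  · rw [delConfig_apply_of_notMem h]

omit [Fintype E] [DecidableEq E] [Fintype V] [DecidableEq V] in
/-- Under separation, deleting the edges at a cluster of `s` does not change the cluster of `t`. -/
lemma cluster_delConfig_eq_of_sep {ends : E → Sym2 V} {s t : V}
    (hsep : ¬ Conn ends allOpen s t) (ω ω' : Config E) :
    cluster ends (delConfig ends (cluster ends ω s) ω') t = cluster ends ω' t := by
  apply Set.Subset.antisymm
  · exact cluster_mono (delConfig_le' ends _ ω') t
  · intro v hv
    exact PASub.conn_delConfig_of_cluster_subset_compl ends
      (cluster_t_subset_compl_of_sep hsep ω ω') hv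

/-! ## The tower identity for the union weight -/

/-- The union weight as a function of the two clusters: `u(W, D) = a(W) + (1 - a(W)) b(D)`. -/
noncomputable def uu (X Y : Finset V) (W D : Set V) : R :=
  aInd X W + (1 - aInd X W) * aInd Y D

/-- `Φ_H(W)(ω') = H(W, C_t(G ∖ W, ω')) · u(W, C_t(G ∖ W, ω'))`. -/
noncomputable def Phi (ends : E → Sym2 V) (t : V) (X Y : Finset V) (H : Set V → Set V → R)
    (W : Set V) : Config E → R :=
  fun ω' => H W (cluster ends (delConfig ends W ω') t) *
    uu X Y W (cluster ends (delConfig ends W ω') t)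

omit [DecidableEq V] [LinearOrder R] [IsStrictOrderedRing R] in
/-- **Tower identity**: `E[H(C_s, C_t) 1_U] = E[Φ̂_H(C_s)]`, `Φ̂_H(W) = E[Φ_H(W)]` — explore the
cluster of `s`; under separation the cluster of `t` is its cluster in `G ∖ C_s`. -/
theorem expect_union_mul_indicator (p : E → R) (ends : E → Sym2 V) (s t : V) (X Y : Finset V)
    (hsep : ¬ Conn ends allOpen s t) (H : Set V → Set V → R) :
    expect p (fun ω => H (cluster ends ω s) (cluster ends ω t) *
        (unionEvent ends s t X Y).indicator 1 ω) =
      expect p (fun ω => expect p (Phi ends t X Y H (cluster ends ω s))) := by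
  classical
  have hΦ : ∀ W, DependsOn (Phi ends t X Y H W) (touches ends W)ᶜ := by
    intro W ω ω' h
    simp only [Phi]
    rw [delConfig_congr h]
  have hS : ∀ W : Set V, DependsOn (· ∈ {ω | cluster ends ω s = W}) (touches ends W) :=
    fun W => dependsOn_clusterEvent ends s W
  have hdisj : ∀ W : Set V, Disjoint (touches ends W) (touches ends W)ᶜ :=
    fun W => disjoint_compl_right
  have hpt : ∀ ω, H (cluster ends ω s) (cluster ends ω t) *
      (unionEvent ends s t X Y).indicator (1 : Config E → R) ω =
        Phi ends t X Y H (cluster ends ω s) ω := by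
    intro ω
    simp only [Phi, uu]
    rw [cluster_delConfig_cluster (notMem_cluster_of_sep hsep ω), indicator_unionEvent_eq]
  have e1 : (fun ω => H (cluster ends ω s) (cluster ends ω t) *
      (unionEvent ends s t X Y).indicator (1 : Config E → R) ω) =
      fun ω => Phi ends t X Y H (cluster ends ω s) ω := funext hpt
  rw [e1, expect_tower p hdisj (S := fun ω => cluster ends ω s) hS hΦ]
  rfl

/-- The unconditioned fibre mean `H₀(W) = E[H(W, C_t)]`. -/
noncomputable def H0 (p : E → R) (ends : E → Sym2 V) (t : V) (H : Set V → Set V → R)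
    (W : Set V) : R :=
  expect p (fun ω' => H W (cluster ends ω' t))

/-- The `Y`-avoidance-restricted fibre mean `H₁(W) = E[H(W, C_t) 1_{t ↮ Y}]`. -/
noncomputable def H1 (p : E → R) (ends : E → Sym2 V) (t : V) (Y : Finset V)
    (H : Set V → Set V → R) (W : Set V) : R :=
  expect p (fun ω' => H W (cluster ends ω' t) * aInd Y (cluster ends ω' t))

omit [Fintype V] [DecidableEq V] [LinearOrder R] [IsStrictOrderedRing R] in
/-- In the fibre over `C_s = W` the union weight splits: `Φ̂_H(W) = a(W) H₀(W) + (1 - a(W)) H₁(W)`. -/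
lemma expect_Phi_eq (p : E → R) (ends : E → Sym2 V) (s t : V) (X Y : Finset V)
    (hsep : ¬ Conn ends allOpen s t) (H : Set V → Set V → R) (ω : Config E) :
    expect p (Phi ends t X Y H (cluster ends ω s)) =
      aInd X (cluster ends ω s) * H0 p ends t H (cluster ends ω s) +
        (1 - aInd X (cluster ends ω s)) * H1 p ends t Y H (cluster ends ω s) := by
  have e : Phi ends t X Y H (cluster ends ω s) =
      (fun ω' => aInd X (cluster ends ω s) * H (cluster ends ω s) (cluster ends ω' t)) +
      (fun ω' => (1 - aInd X (cluster ends ω s)) *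
        (H (cluster ends ω s) (cluster ends ω' t) * aInd Y (cluster ends ω' t))) := by
    funext ω'
    simp only [Phi, uu, Pi.add_apply]
    rw [cluster_delConfig_eq_of_sep hsep ω ω']
    ring
  rw [e, expect_add, expect_const_mul, expect_const_mul]
  rfl

end UnionSep

end Summit.Ventures.PercRepro2
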